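import Literature.AnabelianGeometry.EtaleTheta.SettingModel2
import Literature.AnabelianGeometry.EtaleTheta.SettingModel2LevelKernels
import Literature.AnabelianGeometry.EtaleTheta.SettingModelAbelianShadow
import Literature.AnabelianGeometry.EtaleTheta.ThetaCyclotomes
import Literature.AnabelianGeometry.EtaleTheta.Discharge.Sec1CompatHolds
import HarnessLib

/-!
# The root model of the [EtTh] §1 setting satisfies the §2 hypotheses record `Sec2Hyps`
# (NON-VACUITY of the `D`-indexed binder `hS` of the whole §2 layer; proof-only)

Mochizuki, *The étale theta function …*, Publ. RIMS **45** (2009) [EtTh], Def. 2.5 p. 39 ("`K = K̈`", cf.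
Def. 1.7 (I) p. 27) and §1 p. 13 ("an open immersion `G_{K_N} ↪ (Π^tp_Y)^ell/N·(Δ^tp_Y)^ell` the image of
which … determines a Galois covering `Y_N → Y`", whence `Π^tp_{Y_N} ⊇ Ker(Π^tp_Y ↠ (Π^tp_Y)^ell)`)
[cite: MochizukiEtTh2009, Def 2.5 p.39].

abc-iut cell, layer L2, prover abc-iut-L2-d1 (gen 4); NV-L2 census item (self-named, L2-t1 first refusal):
abc-iut-L2-t8's record `ThetaSetting.Sec2Hyps` (`ThetaCyclotomes.lean`) — the two printed sentences about the
§1 groups that §2 invokes and the root file does not record — is the hypothesis `hS` of essentially every §2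
theorem of the cell; it had NO producer at any model.  Here, at abc-iut-L2-t1's root model
`ThetaSetting.model p` (`K := ℚ_p`, `q_X := p²`, `Π^tp_X := F₂ × G_{ℚ_p}`):

* `fieldKN_bot_two_of_sq` — `K̈ = K(ζ₂, q_X^{1/2}) = ℚ_p(±1, ±p) = ℚ_p`: the clause `Kdd_eq`;
* `ker_toEllM_inf_GtpY_le_YN` — an element of `Ker(Π^tp_X ↠ (Π^tp_X)^ell)` has vanishing `a`- and
  `b`-exponent sums and trivial Galois component (abc-iut-L2-t1's class-1 shadow
  `exponents_eq_zero_and_snd_eq_one_of_mem_KEll`), hence lies in `Δ_{Y_N} × G_{K_N} = Π^tp_{Y_N}` for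
  EVERY `N`: the clause `ker_toEll_le_GtpYN` (the `⊓ Π^tp_Y` is not even needed);
* **`ThetaSetting.model_sec2Hyps : (ThetaSetting.model p).Sec2Hyps`** and the joint satisfiability
  **`ThetaSetting.exists_isEtThOrigin_and_sec2Hyps : ∃ D : ThetaSetting p, D.IsEtThOrigin ∧ D.Sec2Hyps ∧
  D.Compat`** — every cell statement `∀ D, D.Compat → D.Sec2Hyps → D.IsEtThOrigin → …` quantifies over a
  kernel-inhabited domain (the `E`-indexed ones stay root-vacuous by abc-iut-w5-d171's `model_isEmpty_kummerData`);
* the same at abc-iut-L2-t1's FINER root `ThetaSetting.model₂ p` (`Π^tp_X := (F̂₂ ×_Ẑ ℤ) × G_{ℚ_p}`, which also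
  carries `hYcl`): **`ThetaSetting.model₂_sec2Hyps`** (via the level-wise class-1 shadow
  `SettingModel2LevelKernels.mem_KEll₂_iff`: `x = y = 0` at every level `Heis (ℤ/N)`), and
  **`ThetaSetting.exists_isEtThOrigin_and_hYcl_and_sec2Hyps`** — guard, `hYcl` (GAP G-w4d021-2), `Sec2Hyps`
  and `Compat` are JOINTLY satisfiable.
HONEST LIMITS: consistency evidence only (the root model is degenerate along the tempered topology); nothing of
[EtTh] is asserted; no side is taken on [IUTchIII] Cor. 3.12. No definition, no instance, no Prop fact.
-/

noncomputable section

namespace Literature.AnabelianGeometry.EtaleTheta.SettingModel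

open Literature.AnabelianGeometry.SemiGraphs IntermediateField

variable (p : ℕ) [Fact p.Prime]

/-! ### `K̈ = K` at the root: `ℚ_p(±1, ±p) = ℚ_p` -/

/-- For `q = a²` with `a ∈ ℚ_p`: `K_2 = ℚ_p(ζ₂, q^{1/2}) = ℚ_p(±1, ±a) = ℚ_p` ("`K = K̈`", Def. 2.5 p. 39, at
the root model). [cite: MochizukiEtTh2009, Def 2.5 p.39] -/
theorem fieldKN_bot_two_of_sq {a : PadicAlgCl p} (ha : a ∈ (⊥ : IntermediateField ℚ_[p] (PadicAlgCl p))) :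
    fieldKN ⊥ (a ^ 2) 2 = ⊥ := by
  unfold fieldKN
  refine le_antisymm (IntermediateField.adjoin_le_iff.mpr ?_) bot_le
  rintro x (hx | hx)
  · exact hx
  · simp only [PNat.val_ofNat, Set.mem_setOf_eq] at hx
    rcases hx with hx | hx
    · -- `x² = 1 ⇒ x = ±1`
      have hx' : x ^ 2 = 1 ^ 2 := by rw [one_pow]; exact hx
      rcases sq_eq_sq_iff_eq_or_eq_neg.mp hx' with rfl | rfl
      · exact (⊥ : IntermediateField ℚ_[p] (PadicAlgCl p)).one_mem
      · exact (⊥ : IntermediateField ℚ_[p] (PadicAlgCl p)).neg_mem (one_mem _)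
    · -- `x² = a² ⇒ x = ±a`
      rcases sq_eq_sq_iff_eq_or_eq_neg.mp hx with rfl | rfl
      · exact ha
      · exact (⊥ : IntermediateField ℚ_[p] (PadicAlgCl p)).neg_mem ha

/-- **`K̈ = K` at the root model** (`K := ℚ_p`, `q_X := p²`): the clause `Sec2Hyps.Kdd_eq`.
[cite: MochizukiEtTh2009, Def 2.5 p.39] -/
theorem model_Kdd_eq : (ThetaSetting.model p).Kdd = (ThetaSetting.model p).K := by
  change fieldKN ⊥ (qModel p) 2 = ⊥
  exact fieldKN_bot_two_of_sq p (IntermediateField.natCast_mem _ p)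

/-! ### `Ker(Π^tp_X ↠ (Π^tp_X)^ell) ⊆ Π^tp_{Y_N}` at the root -/

/-- **`Ker(Π^tp_X ↠ (Π^tp_X)^ell) ≤ Π^tp_{Y_N}` for every `N` at the root model**: such an element has
vanishing exponent sums (`x = y = 0` in `Heis ℤ`, so `x = 0 ∧ N ∣ y`) and trivial Galois component
("`G_{K_N} ↪ (Π^tp_Y)^ell/N·(Δ^tp_Y)^ell` … determines `Y_N → Y`", p. 13). [cite: MochizukiEtTh2009, §1 p.13] -/
theorem KEll_le_YN (N : ℕ+) : KEll p ≤ YN p N := by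
  intro g hg
  obtain ⟨hx, hy, h2⟩ := exponents_eq_zero_and_snd_eq_one_of_mem_KEll p hg
  refine ⟨?_, ?_⟩
  · -- `Del.val g.1 ∈ deltaYN N = heisHom⁻¹ {x = 0, N ∣ y}`
    change Del.val g.1 ∈ deltaYN N
    rw [deltaYN, Subgroup.mem_comap]
    exact ⟨hx, by rw [hy]; exact dvd_zero _⟩
  · -- the Galois component is `1 ∈ G_{K_N}`
    change g.2 ∈ gKN p N
    rw [h2]
    exact (gKN p N).one_mem

/-- The clause `Sec2Hyps.ker_toEll_le_GtpYN` at the root model (the intersection with `Π^tp_Y` is not even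
needed). [cite: MochizukiEtTh2009, §1 p.13] -/
theorem ker_toEllM_inf_GtpY_le_YN (N : ℕ+) :
    ((ThetaSetting.model p).thetaToEll.comp (ThetaSetting.model p).toTheta).ker ⊓
        (ThetaSetting.model p).GtpY ≤ (ThetaSetting.model p).GtpYN N := by
  intro g hg
  have hg1 : g ∈ KEll p := by
    rw [← ker_toEllM p]
    exact hg.1
  exact KEll_le_YN p N hg1

/-! ### The record and the joint satisfiability at the root model -/

/-- **The root model satisfies `Sec2Hyps`** ("`K = K̈`" and "`Π^tp_{Y_N} ⊇ Ker(Π^tp_Y ↠ (Π^tp_Y)^ell)`").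
[cite: MochizukiEtTh2009, Def 2.5 p.39] -/
theorem _root_.Literature.AnabelianGeometry.EtaleTheta.ThetaSetting.model_sec2Hyps :
    (ThetaSetting.model p).Sec2Hyps where
  Kdd_eq := model_Kdd_eq p
  ker_toEll_le_GtpYN := ker_toEllM_inf_GtpY_le_YN p

/-- **Joint satisfiability of the root, its guard and the §2 hypotheses**: `∃ D : ThetaSetting p,
D.IsEtThOrigin ∧ D.Sec2Hyps ∧ D.Compat` — every cell statement `∀ D, D.Compat → D.Sec2Hyps → D.IsEtThOrigin
→ …` is non-vacuously quantified (`Compat` holds for every `D`, abc-iut `ThetaSetting.compat`).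
[cite: MochizukiEtTh2009, Def 2.5 p.39] -/
theorem _root_.Literature.AnabelianGeometry.EtaleTheta.ThetaSetting.exists_isEtThOrigin_and_sec2Hyps :
    ∃ D : ThetaSetting p, D.IsEtThOrigin ∧ D.Sec2Hyps ∧ D.Compat :=
  ⟨ThetaSetting.model p, ThetaSetting.model_isEtThOrigin p, ThetaSetting.model_sec2Hyps p,
    (ThetaSetting.model p).compat⟩

/-! ### The same at the finer root `ThetaSetting.model₂ p` (which also carries `hYcl`) -/

/-- **`K̈ = K` at the finer root model** (`K := ℚ_p`, `q_X := p²`). [cite: MochizukiEtTh2009, Def 2.5 p.39] -/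
theorem model₂_Kdd_eq : (ThetaSetting.model₂ p).Kdd = (ThetaSetting.model₂ p).K := by
  change fieldKN ⊥ (qModel p) 2 = ⊥
  exact fieldKN_bot_two_of_sq p (IntermediateField.natCast_mem _ p)

/-- **`Ker(Π^tp_X ↠ (Π^tp_X)^ell) ∩ Π^tp_Y ≤ Π^tp_{Y_N}` at the finer root model**: an element of `KEll₂` has
`x = y = 0` at every level `Heis (ℤ/N)` and trivial Galois component (`mem_KEll₂_iff`), and lies in `Ker ê`
by the `Π^tp_Y`-hypothesis, hence in `Δ^tp_{Y_N} × G_{K_N}` (p. 13). [cite: MochizukiEtTh2009, §1 p.13] -/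
theorem KEll₂_inf_ker_toZM₂_le_YN₂ (N : ℕ+) : KEll₂ p ⊓ (toZM₂ p).ker ≤ YN₂ p N := by
  rintro g ⟨hg, hgZ⟩
  obtain ⟨hxy, h2⟩ := (mem_KEll₂_iff p g).mp hg
  rw [ker_toZM₂] at hgZ
  refine ⟨⟨hgZ.1, ?_⟩, ?_⟩
  · -- `levelHom N g.1 = ĥ_N(pr₁ g.1) ∈ {x = 0, y = 0}`
    change levelHom N g.1 ∈ (Heis.zAxis : Subgroup (Heis (ZMod N)))
    exact hxy N
  · change g.2 ∈ gKN p N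
    rw [h2]
    exact (gKN p N).one_mem

/-- The clause `Sec2Hyps.ker_toEll_le_GtpYN` at the finer root model. [cite: MochizukiEtTh2009, §1 p.13] -/
theorem ker_toEllM₂_inf_GtpY_le_YN₂ (N : ℕ+) :
    ((ThetaSetting.model₂ p).thetaToEll.comp (ThetaSetting.model₂ p).toTheta).ker ⊓
        (ThetaSetting.model₂ p).GtpY ≤ (ThetaSetting.model₂ p).GtpYN N := by
  intro g hg
  have hg1 : g ∈ KEll₂ p := by
    rw [← ker_toEllM₂ p]
    exact hg.1
  exact KEll₂_inf_ker_toZM₂_le_YN₂ p N ⟨hg1, hg.2⟩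

/-- **The finer root model satisfies `Sec2Hyps`.** [cite: MochizukiEtTh2009, Def 2.5 p.39] -/
theorem _root_.Literature.AnabelianGeometry.EtaleTheta.ThetaSetting.model₂_sec2Hyps :
    (ThetaSetting.model₂ p).Sec2Hyps where
  Kdd_eq := model₂_Kdd_eq p
  ker_toEll_le_GtpYN := ker_toEllM₂_inf_GtpY_le_YN₂ p

/-- **Guard + `hYcl` + §2 hypotheses + `Compat` are JOINTLY satisfiable** (at `ThetaSetting.model₂ p`): every
cell statement `∀ D, D.Compat → D.Sec2Hyps → D.IsEtThOrigin → hYcl D → …` (GAP G-w4d021-2 binder `hYcl`) is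
non-vacuously quantified. [cite: MochizukiEtTh2009, Def 2.5 p.39] -/
theorem _root_.Literature.AnabelianGeometry.EtaleTheta.ThetaSetting.exists_isEtThOrigin_and_hYcl_and_sec2Hyps :
    ∃ D : ThetaSetting p, D.IsEtThOrigin ∧
      (D.DtpY.map D.toHat.toMonoidHom).topologicalClosure ≤
        D.DtpY.map D.toHat.toMonoidHom ⊔ (⁅⁅D.DeltaHat, D.DeltaHat⁆, D.DeltaHat⁆).topologicalClosure ∧
      D.Sec2Hyps ∧ D.Compat :=
  ⟨ThetaSetting.model₂ p, ThetaSetting.model₂_isEtThOrigin p, hYcl_model₂ p, ThetaSetting.model₂_sec2Hyps p,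
    (ThetaSetting.model₂ p).compat⟩

end Literature.AnabelianGeometry.EtaleTheta.SettingModel

end
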